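import Summits.QuantumFields.BalabanUV.Beta.GAN24.LatticeKernelConvolution
import Literature.MathematicalPhysics.QuantumFieldTheory.Balaban1983to89.B4Green244

/-!
# `BalabanUV.Beta.GAN24.LatticeKernelReality` — binder row G-an2-4 / (CONV-C), STENCIL slot, campaign «E3Shape» (`SKELETON-S3.md` node S3-L1,
# ANALYSIS HALF, continued): REFLECTION, CONJUGATION and REALITY of pv17's lattice kernels, and the product theorem for `Re`-READ kernels
# `Σ'_w Re K[A](x − w) · Re K[C](w − y) = Re K[A·C](x − y)` (the form of an2's `KInv = Re K[fibInv]`)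

NOT IN PRINT; OUR BOOKKEEPING (engine «LK-CONV*» part 1b, CLAIMS l.4206; filed with `GAN24/LatticeKernelConvolution` on gan24-p1-g3's RULINGS-2 l.4221;
unit b2b-balaban-gan24-formalise-leaf-07, gen 9).  HONEST FRAMING (cell contract, verbatim): «discharging `BetaPertH` makes Bałaban's UV stability
UNCONDITIONAL — a real constructive-QFT result; it is NOT the continuum limit and NOT the Clay problem.»  HONEST DEPENDENCY (verbatim): «continuum YM
on T⁴ ⇐ BetaPertH ∧ nine spine estimates (0/9 proved); BetaPertH ⇐ (D1) ∧ (D4) ∧ CAP+tail; G-an2-4 gates asym, D1 and NE2/3/4.»  [folklore] Fourier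
analysis on `ℤ^{d+1}`: cites nothing, mints no `def … : Prop`, asserts no statement of Bałaban's, instantiates no wall binder.  NOT summit progress.

## Why (context only; asserted nowhere below)

an2's packed resolvent is READ AS A REAL PART, `KInv N x y a b = Re K[fibInv N i j](quo x − quo y)` (`CombesThomasFibre.KInv_eq_re_latticeKernel`), and
so are `wH`, `GamΦ`, `wΦ`.  A sandwich `K_N ∘ V ∘ K_N` (S3-L1) composes PRODUCTS OF REAL PARTS over intermediate sites; these are real parts of products
only if each factor is real.  THIS FILE supplies the generic criterion — a symbol with the real-zone symmetry `conj G(−p) = G(p)` has a real lattice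
kernel — and the `Re`-read form of the convolution theorem of `GAN24/LatticeKernelConvolution`.  (The symmetry of `fibInv` itself = the reality of
the typed KKT block system is the sibling engine «KKT-REAL*».)

## Contents (all [folklore])
§1 `neg_mem_BZ_iff`, `neg_preimage_BZ`, `ofRealVec_neg`, `phase_neg_left`; **`latticeKernel_reflect : K[G(−·)](x) = K[G](−x)`** (Lebesgue measure on
   `ℝ^{d+1}` is negation invariant, `Measure.measurePreserving_neg`); `conj_fourierBox`, **`conj_latticeKernel : conj K[G](x) = K[conj ∘ G ∘ (−·)](x)`**;
   **`latticeKernel_im_eq_zero`**: `(∀ s ∈ BZ, conj (G (ofRealVec (−s))) = G (ofRealVec s)) → Im K[G](x) = 0`; `latticeKernel_eq_re`;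
   **`tsum_re_latticeKernel_mul_sub`** and `summable_re_latticeKernel_mul_sub`.
WHAT IS NOT HERE: the symmetry of any particular symbol (an2's `fibInv`: «KKT-REAL*»); two-momentum forms.  NOT BetaPertH, NOT continuum, NOT Clay.
-/

noncomputable section

open Complex Set MeasureTheory
open Literature.MathematicalPhysics.QuantumFieldTheory.Balaban1983to89
open B4Strip (ofRealVec Strip)
open B4ContourShift (BZ latticeKernel StripRegular supNorm latticeKernel_decay)
open Summit.QuantumFields.BalabanUV.Beta.GAN24.LatticeKernelConvolution (tsum_latticeKernel_mul_sub summable_latticeKernel_mul_sub)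
open scoped Real

namespace Summit.QuantumFields.BalabanUV.Beta.GAN24.LatticeKernelReality

variable {d : ℕ}

/-! ## §1 Reflection, conjugation, and REALITY of the lattice kernel (for an2's `Re`-read kernels) -/

section Reality

/-- [folklore] the Brillouin zone is symmetric under `p ↦ −p`. -/
theorem neg_mem_BZ_iff (p : Fin (d + 1) → ℝ) : -p ∈ BZ (d + 1) ↔ p ∈ BZ (d + 1) := by
  simp only [BZ, Set.mem_Icc, Pi.le_def, Pi.neg_apply]
  constructor
  · rintro ⟨h1, h2⟩; exact ⟨fun i => by linarith [h2 i], fun i => by linarith [h1 i]⟩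
  · rintro ⟨h1, h2⟩; exact ⟨fun i => by linarith [h2 i], fun i => by linarith [h1 i]⟩

/-- [folklore] hence `(−·)⁻¹' BZ = BZ`. -/
theorem neg_preimage_BZ : (Neg.neg : (Fin (d + 1) → ℝ) → (Fin (d + 1) → ℝ)) ⁻¹' BZ (d + 1) = BZ (d + 1) :=
  Set.ext fun p => neg_mem_BZ_iff p

/-- [folklore] `ofRealVec (−p) = −ofRealVec p`. -/
theorem ofRealVec_neg (p : Fin (d + 1) → ℝ) : ofRealVec (-p) = -ofRealVec p := by
  funext μ; simp [ofRealVec]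

/-- [folklore] `(−p)·x = p·(−x)`. -/
theorem phase_neg_left (p : Fin (d + 1) → ℝ) (x : Fin (d + 1) → ℤ) :
    B4ContourShift.phase (-p) x = B4ContourShift.phase p (-x) := by
  unfold B4ContourShift.phase
  refine Finset.sum_congr rfl fun μ _ => ?_
  simp only [Pi.neg_apply, Complex.ofReal_neg, Int.cast_neg]
  ring

/-- [folklore] **REFLECTION**: the kernel of the reflected symbol is the reflected kernel, `K[G(−·)](x) = K[G](−x)` (the substitution
`p ↦ −p` on the symmetric zone; Lebesgue measure on `ℝ^{d+1}` is negation invariant). -/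
theorem latticeKernel_reflect (G : (Fin (d + 1) → ℂ) → ℂ) (x : Fin (d + 1) → ℤ) :
    latticeKernel (fun p => G (-p)) x = latticeKernel G (-x) := by
  unfold latticeKernel B4ContourShift.fourierBox
  congr 1
  have h := (Measure.measurePreserving_neg (volume : Measure (Fin (d + 1) → ℝ))).setIntegral_preimage_emb
    (MeasurableEquiv.neg (Fin (d + 1) → ℝ)).measurableEmbedding (B4ContourShift.integrand (fun p => G (-p)) x) (BZ (d + 1))
  rw [neg_preimage_BZ] at h
  rw [← h]
  refine setIntegral_congr_fun measurableSet_Icc fun p _ => ?_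
  unfold B4ContourShift.integrand
  simp only [ofRealVec_neg, neg_neg, phase_neg_left]

/-- [folklore] conjugating the un-normalised Fourier integral conjugates the symbol and reflects the lattice point. -/
theorem conj_fourierBox (G : (Fin (d + 1) → ℂ) → ℂ) (x : Fin (d + 1) → ℤ) :
    (starRingEnd ℂ) (B4ContourShift.fourierBox G x) = B4ContourShift.fourierBox (fun p => (starRingEnd ℂ) (G p)) (-x) := by
  unfold B4ContourShift.fourierBox
  rw [← integral_conj]
  refine setIntegral_congr_fun measurableSet_Icc fun p _ => ?_
  unfold B4ContourShift.integrand
  rw [map_mul, ← Complex.exp_conj, map_mul, Complex.conj_I]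
  have hph : (starRingEnd ℂ) (B4ContourShift.phase p x) = B4ContourShift.phase p x := by
    rw [B4ContourShift.phase_eq_ofReal, Complex.conj_ofReal]
  have hneg : B4ContourShift.phase p (-x) = -B4ContourShift.phase p x := by
    rw [B4ContourShift.phase_eq_ofReal, B4ContourShift.phase_eq_ofReal, ← Complex.ofReal_neg, ← Finset.sum_neg_distrib]
    congr 1
    refine Finset.sum_congr rfl fun μ _ => ?_
    simp only [Pi.neg_apply, Int.cast_neg]
    ring
  rw [hph, hneg]
  congr 2
  ring

/-- [folklore] **CONJUGATION**: `conj K[G](x) = K[conj ∘ G ∘ (−·)](x)`. -/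
theorem conj_latticeKernel (G : (Fin (d + 1) → ℂ) → ℂ) (x : Fin (d + 1) → ℤ) :
    (starRingEnd ℂ) (latticeKernel G x) = latticeKernel (fun p => (starRingEnd ℂ) (G (-p))) x := by
  rw [latticeKernel_reflect (fun p => (starRingEnd ℂ) (G p)) x]
  unfold latticeKernel
  rw [Complex.real_smul, Complex.real_smul, map_mul, Complex.conj_ofReal, conj_fourierBox]

/-- [folklore] **REALITY**: a symbol with the real-zone conjugation symmetry `conj G(−p) = G(p)` (the symbols of REAL lattice operators, e.g.
trigonometric polynomials with real coefficients and their inverses) has a REAL lattice kernel: `Im K[G](x) = 0`. -/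
theorem latticeKernel_im_eq_zero {G : (Fin (d + 1) → ℂ) → ℂ}
    (hG : ∀ s ∈ BZ (d + 1), (starRingEnd ℂ) (G (ofRealVec (-s))) = G (ofRealVec s)) (x : Fin (d + 1) → ℤ) :
    (latticeKernel G x).im = 0 := by
  have h : (starRingEnd ℂ) (latticeKernel G x) = latticeKernel G x := by
    rw [conj_latticeKernel]
    refine B4Green244.latticeKernel_congr (fun s hs => ?_) x
    show (starRingEnd ℂ) (G (-ofRealVec s)) = G (ofRealVec s)
    rw [← ofRealVec_neg]
    exact hG s hs
  exact Complex.conj_eq_iff_im.mp h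

/-- [folklore] … so the kernel IS its real part. -/
theorem latticeKernel_eq_re {G : (Fin (d + 1) → ℂ) → ℂ}
    (hG : ∀ s ∈ BZ (d + 1), (starRingEnd ℂ) (G (ofRealVec (-s))) = G (ofRealVec s)) (x : Fin (d + 1) → ℤ) :
    latticeKernel G x = (((latticeKernel G x).re : ℝ) : ℂ) := by
  conv_lhs => rw [← Complex.re_add_im (latticeKernel G x), latticeKernel_im_eq_zero hG x]
  simp

/-- [folklore] **THE PRODUCT THEOREM FOR `Re`-READ KERNELS** (the form of an2's `KInv = Re K[fibInv]`, `CombesThomasFibre.KInv_eq_re_latticeKernel`):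
for conjugation-symmetric strip-regular symbols, `Σ'_w Re K[A](x − w) · Re K[C](w − y) = Re K[A·C](x − y)`. -/
theorem tsum_re_latticeKernel_mul_sub {A C : (Fin (d + 1) → ℂ) → ℂ} {κ MA MC : ℝ}
    (hA : StripRegular A κ MA) (hC : StripRegular C κ MC) (hκ : 0 < κ)
    (hAs : ∀ s ∈ BZ (d + 1), (starRingEnd ℂ) (A (ofRealVec (-s))) = A (ofRealVec s))
    (hCs : ∀ s ∈ BZ (d + 1), (starRingEnd ℂ) (C (ofRealVec (-s))) = C (ofRealVec s)) (x y : Fin (d + 1) → ℤ) :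
    ∑' w, (latticeKernel A (x - w)).re * (latticeKernel C (w - y)).re = (latticeKernel (fun p => A p * C p) (x - y)).re := by
  have h := tsum_latticeKernel_mul_sub hA hC hκ x y
  have e : ∀ w, latticeKernel A (x - w) * latticeKernel C (w - y) =
      ((((latticeKernel A (x - w)).re * (latticeKernel C (w - y)).re : ℝ)) : ℂ) := by
    intro w
    rw [Complex.ofReal_mul, ← latticeKernel_eq_re hAs, ← latticeKernel_eq_re hCs]
  rw [tsum_congr e, ← Complex.ofReal_tsum] at h
  have h' := congrArg Complex.re h
  rw [Complex.ofReal_re] at h'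
  exact h'

/-- [folklore] summability of the `Re`-read summand. -/
theorem summable_re_latticeKernel_mul_sub {A C : (Fin (d + 1) → ℂ) → ℂ} {κ MA MC : ℝ}
    (hA : StripRegular A κ MA) (hC : StripRegular C κ MC) (hκ : 0 < κ) (x y : Fin (d + 1) → ℤ) :
    Summable fun w => (latticeKernel A (x - w)).re * (latticeKernel C (w - y)).re := by
  refine Summable.of_norm_bounded (summable_latticeKernel_mul_sub hA hC hκ x y).norm fun w => ?_
  rw [Real.norm_eq_abs, abs_mul, norm_mul]
  exact mul_le_mul (Complex.abs_re_le_norm _) (Complex.abs_re_le_norm _) (abs_nonneg _) (norm_nonneg _)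

end Reality

end Summit.QuantumFields.BalabanUV.Beta.GAN24.LatticeKernelReality

end
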